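import Mathlib.Geometry.Manifold.ContMDiff.Atlas
import Mathlib.Geometry.Manifold.Diffeomorph
import HarnessLib

/-!
# Transport of a manifold structure along a bijection

General infrastructure ("transport of structure", Bourbaki, *Theory of Sets*, Ch. IV, §1,
no. 5; for manifolds: the structure carried over by a bijection so that the bijection becomes a
diffeomorphism — Kobayashi–Nomizu, *Foundations of Differential Geometry* I, Ch. I, §1, p. 3,
"a differentiable structure can be transferred by a bijection"):

* `Transfer e` — for a bijection `e : M ≃ α` from a topological space / charted space / `C^n`
  manifold `M` onto a bare type `α`, the type `α` equipped with the transported topology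
  (`instTopologicalSpace`, making `e` the homeomorphism `Transfer.homeomorph e`), the transported
  atlas (`instChartedSpace`: the charts `c ∘ e⁻¹`, `Transfer.liftChart`), every structure groupoid
  of `M` (`instHasGroupoid`: changes of transported charts are changes of charts of `M` up to
  restriction, `liftChart_symm_trans_liftChart`), hence `IsManifold` (`instIsManifold`), and the
  Hausdorff / second countability / connectedness properties; `e` becomes a `C^n` diffeomorphism
  `Transfer.diffeomorph e : M ≃ₘ^n⟮I, I⟯ Transfer e` (`contMDiff_homeomorph`,
  `contMDiff_homeomorph_symm`), and transported maximal-atlas charts are maximal-atlas charts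
  (`liftChart_mem_maximalAtlas`). Use: replacing a manifold by an isomorphic copy on a
  prescribed carrier (e.g. a subset of a fixed type, to index isomorphism classes by a set —
  Sbierski, Ann. Henri Poincaré 17 (2016), §3.3: "any GHD is isometric to one whose underlying
  set is a subset of `X × ℝ`"; Choquet-Bruhat–Geroch 1969, p. 333: the consumer is
  `Literature.Geometry.Lorentzian.CauchyDevelopmentTransport`, which realises every Cauchy
  development, up to isometry, on a subset of a fixed type). Smooth embeddings into `M` followed
  by the diffeomorphism stay smooth embeddings by the tree lemma
  `Manifold.IsSmoothEmbedding.diffeomorph_comp` (`Literature.Topology.FourManifolds.ClosedBallProofs`).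

Everything is proved; no named facts.

## References

* N. Bourbaki, *Theory of Sets*, Ch. IV §1 no. 5 (transport of structure). [folklore]
* S. Kobayashi, K. Nomizu, *Foundations of Differential Geometry* I (1963), Ch. I §1. [folklore]
-/

noncomputable section

open Set Function TopologicalSpace Topology
open scoped Manifold ContDiff Topology

namespace Literature.Geometry.Manifold

universe u v

/-- **Transport of structure**: the target type `α` of a bijection `e : M ≃ α`, as a type synonym
on which the structures of `M` are transported along `e` (instances below). [folklore] -/
@[nolint unusedArguments]
def Transfer {M : Type u} {α : Type v} (_e : M ≃ α) : Type v := α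

namespace Transfer

variable {M : Type u} {α : Type v} (e : M ≃ α)

/-- The bijection `e`, retyped as `M ≃ Transfer e`. [folklore] -/
def equiv : M ≃ Transfer e := e

/-- `Transfer e` is nonempty when `M` is. [folklore] -/
instance [Nonempty M] : Nonempty (Transfer e) := (equiv e).symm.nonempty

/-! ### Topology -/

section Topology

variable [t : TopologicalSpace M]

/-- The transported topology: the one making `e` a homeomorphism. [folklore] -/
instance instTopologicalSpace : TopologicalSpace (Transfer e) := t.induced (equiv e).symm

/-- `e⁻¹` is inducing for the transported topology (by definition). [folklore] -/
theorem isInducing_equiv_symm : IsInducing (equiv e).symm := ⟨rfl⟩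

/-- `e` as a homeomorphism `M ≃ₜ Transfer e`. [folklore] -/
def homeomorph : M ≃ₜ Transfer e :=
  ((equiv e).symm.toHomeomorphOfIsInducing (isInducing_equiv_symm e)).symm

/-- The homeomorphism is `e`. [folklore] -/
theorem homeomorph_apply (x : M) : homeomorph e x = equiv e x := rfl

/-- Its inverse is `e⁻¹`. [folklore] -/
theorem homeomorph_symm_apply (a : Transfer e) : (homeomorph e).symm a = (equiv e).symm a :=
  rfl

/-- The homeomorphism is `e` (coercion form). [folklore] -/
theorem coe_homeomorph : ⇑(homeomorph e) = equiv e := rfl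

/-- The transported topology is Hausdorff when `M` is. [folklore] -/
instance [T2Space M] : T2Space (Transfer e) := (homeomorph e).symm.isEmbedding.t2Space

/-- The transported topology is second countable when `M` is. [folklore] -/
instance [SecondCountableTopology M] : SecondCountableTopology (Transfer e) :=
  (homeomorph e).symm.secondCountableTopology

/-- The transported topology is connected when `M` is. [folklore] -/
instance [ConnectedSpace M] : ConnectedSpace (Transfer e) := by
  rw [connectedSpace_iff_univ, ← (homeomorph e).range_coe]
  exact isConnected_range (homeomorph e).continuous

/-- The transported topology is locally compact when `M` is. [folklore] -/
instance [LocallyCompactSpace M] : LocallyCompactSpace (Transfer e) :=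
  (homeomorph e).symm.isOpenEmbedding.locallyCompactSpace

end Topology

/-! ### Charts -/

section Charts

variable [TopologicalSpace M] {H : Type*} [TopologicalSpace H]

/-- The transported chart `c ∘ e⁻¹` of a chart `c` of `M`. [folklore] -/
def liftChart (c : OpenPartialHomeomorph M H) : OpenPartialHomeomorph (Transfer e) H :=
  (homeomorph e).symm.toOpenPartialHomeomorph ≫ₕ c

/-- `(c ∘ e⁻¹) a = c (e⁻¹ a)`. [folklore] -/
@[simp] theorem liftChart_apply (c : OpenPartialHomeomorph M H) (a : Transfer e) :
    liftChart e c a = c ((homeomorph e).symm a) := rfl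

/-- `(c ∘ e⁻¹)⁻¹ u = e (c⁻¹ u)`. [folklore] -/
@[simp] theorem liftChart_symm_apply (c : OpenPartialHomeomorph M H) (u : H) :
    (liftChart e c).symm u = homeomorph e (c.symm u) := rfl

/-- The source of `c ∘ e⁻¹` is `e (c.source)`. [folklore] -/
@[simp] theorem liftChart_source (c : OpenPartialHomeomorph M H) :
    (liftChart e c).source = (homeomorph e).symm ⁻¹' c.source := by
  simp [liftChart]

/-- The target of `c ∘ e⁻¹` is that of `c`. [folklore] -/
@[simp] theorem liftChart_target (c : OpenPartialHomeomorph M H) :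
    (liftChart e c).target = c.target := by
  simp [liftChart]

/-- **Changes of transported charts are changes of charts of `M`** (as partial homeomorphisms of
`H`, up to equality of sources and values): `(c ∘ e⁻¹)⁻¹ ≫ (c' ∘ e⁻¹) ≈ c⁻¹ ≫ c'`. [folklore] -/
theorem liftChart_symm_trans_liftChart (c c' : OpenPartialHomeomorph M H) :
    (liftChart e c).symm ≫ₕ liftChart e c' ≈ c.symm ≫ₕ c' := by
  constructor
  · ext u
    simp [liftChart]
  · intro u _
    simp [liftChart]

variable [ChartedSpace H M]

/-- **The transported atlas**: the charts `c ∘ e⁻¹`, `c` a chart of `M`. [folklore] -/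
instance instChartedSpace : ChartedSpace H (Transfer e) where
  atlas := liftChart e '' atlas H M
  chartAt a := liftChart e (chartAt H ((homeomorph e).symm a))
  mem_chart_source a := by simp
  chart_mem_atlas _ := mem_image_of_mem _ (chart_mem_atlas H _)

/-- The preferred chart at `a` is the transport of the preferred chart at `e⁻¹ a`. [folklore] -/
theorem chartAt_eq (a : Transfer e) :
    chartAt H a = liftChart e (chartAt H ((homeomorph e).symm a)) := rfl

/-- The preferred chart at `e x` is the transport of the preferred chart at `x`. [folklore] -/
theorem chartAt_homeomorph (x : M) :
    chartAt H (homeomorph e x) = liftChart e (chartAt H x) := by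
  rw [chartAt_eq, Homeomorph.symm_apply_apply]

/-- Description of the transported atlas. [folklore] -/
theorem mem_atlas_iff {c : OpenPartialHomeomorph (Transfer e) H} :
    c ∈ atlas H (Transfer e) ↔ ∃ c' ∈ atlas H M, liftChart e c' = c := Iff.rfl

/-- Transports of charts are charts. [folklore] -/
theorem liftChart_mem_atlas {c : OpenPartialHomeomorph M H} (hc : c ∈ atlas H M) :
    liftChart e c ∈ atlas H (Transfer e) := ⟨c, hc, rfl⟩

/-- Every structure groupoid of `M` is a structure groupoid of the transported charted space. [folklore] -/
instance instHasGroupoid (G : StructureGroupoid H) [HasGroupoid M G] : HasGroupoid (Transfer e) G where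
  compatible := by
    rintro _ _ ⟨c, hc, rfl⟩ ⟨c', hc', rfl⟩
    exact G.mem_of_eqOnSource (HasGroupoid.compatible hc hc') (liftChart_symm_trans_liftChart e c c')

/-- Transported maximal-atlas charts are maximal-atlas charts. [folklore] -/
theorem liftChart_mem_maximalAtlas (G : StructureGroupoid H) [HasGroupoid M G]
    {c : OpenPartialHomeomorph M H} (hc : c ∈ G.maximalAtlas M) :
    liftChart e c ∈ G.maximalAtlas (Transfer e) := by
  rintro _ ⟨c', hc', rfl⟩
  exact ⟨G.mem_of_eqOnSource (G.compatible_of_mem_maximalAtlas hc (G.subset_maximalAtlas hc'))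
      (liftChart_symm_trans_liftChart e c c'),
    G.mem_of_eqOnSource (G.compatible_of_mem_maximalAtlas (G.subset_maximalAtlas hc') hc)
      (liftChart_symm_trans_liftChart e c' c)⟩

end Charts

/-! ### Smoothness -/

section Smooth

variable {𝕜 : Type*} [NontriviallyNormedField 𝕜] {E : Type*} [NormedAddCommGroup E]
  [NormedSpace 𝕜 E] {H : Type*} [TopologicalSpace H] {I : ModelWithCorners 𝕜 E H} {n : ℕ∞ω}
  [TopologicalSpace M] [ChartedSpace H M]

/-- The transported charted space is a `C^n` manifold when `M` is. [folklore] -/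
instance instIsManifold [IsManifold I n M] : IsManifold I n (Transfer e) :=
  IsManifold.mk' I n (Transfer e)

/-- **`e : M → Transfer e` is `C^n`**: near `x` it is `(chart at e x)⁻¹ ∘ (chart at x)`. [folklore] -/
theorem contMDiff_homeomorph [IsManifold I n M] : ContMDiff I I n (homeomorph e) := by
  intro x
  have h1 : ContMDiffAt I I n (chartAt H x) x :=
    contMDiffAt_of_mem_maximalAtlas (IsManifold.chart_mem_maximalAtlas x) (mem_chart_source H x)
  have h2 : ContMDiffAt I I n (chartAt H (homeomorph e x)).symm (chartAt H x x) := by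
    refine contMDiffAt_symm_of_mem_maximalAtlas (IsManifold.chart_mem_maximalAtlas _) ?_
    rw [chartAt_homeomorph, liftChart_target]
    exact mem_chart_target H x
  refine (h2.comp x h1).congr_of_eventuallyEq ?_
  filter_upwards [chart_source_mem_nhds H x] with y hy
  simp [chartAt_homeomorph, hy]

/-- **`e⁻¹ : Transfer e → M` is `C^n`.** [folklore] -/
theorem contMDiff_homeomorph_symm [IsManifold I n M] : ContMDiff I I n (homeomorph e).symm := by
  intro a
  have h1 : ContMDiffAt I I n (chartAt H a) a :=
    contMDiffAt_of_mem_maximalAtlas (IsManifold.chart_mem_maximalAtlas a) (mem_chart_source H a)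
  have h2 : ContMDiffAt I I n (chartAt H ((homeomorph e).symm a)).symm (chartAt H a a) := by
    refine contMDiffAt_symm_of_mem_maximalAtlas (IsManifold.chart_mem_maximalAtlas _) ?_
    rw [chartAt_eq, liftChart_apply]
    exact mem_chart_target H _
  refine (h2.comp a h1).congr_of_eventuallyEq ?_
  filter_upwards [chart_source_mem_nhds H a] with b hb
  rw [chartAt_eq, liftChart_source, mem_preimage] at hb
  simp only [chartAt_eq, comp_apply, liftChart_apply]
  rw [OpenPartialHomeomorph.left_inv _ hb]

/-- **`e` as a `C^n` diffeomorphism `M ≃ₘ Transfer e`** (transport of structure). [folklore] -/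
def diffeomorph [IsManifold I n M] : M ≃ₘ^n⟮I, I⟯ Transfer e where
  toEquiv := (homeomorph e).toEquiv
  contMDiff_toFun := contMDiff_homeomorph e
  contMDiff_invFun := contMDiff_homeomorph_symm e

/-- The diffeomorphism is the homeomorphism `e`. [folklore] -/
@[simp] theorem coe_diffeomorph [IsManifold I n M] :
    ⇑(diffeomorph e : M ≃ₘ^n⟮I, I⟯ Transfer e) = homeomorph e := rfl

/-- Its inverse is `e⁻¹`. [folklore] -/
@[simp] theorem coe_diffeomorph_symm [IsManifold I n M] :
    ⇑(diffeomorph e : M ≃ₘ^n⟮I, I⟯ Transfer e).symm = (homeomorph e).symm := rfl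

/-- The diffeomorphism is `e`. [folklore] -/
theorem diffeomorph_apply [IsManifold I n M] (x : M) :
    (diffeomorph e : M ≃ₘ^n⟮I, I⟯ Transfer e) x = equiv e x := rfl

/-- Its inverse is `e⁻¹`. [folklore] -/
theorem diffeomorph_symm_apply [IsManifold I n M] (a : Transfer e) :
    (diffeomorph e : M ≃ₘ^n⟮I, I⟯ Transfer e).symm a = (equiv e).symm a := rfl

end Smooth

end Transfer

end Literature.Geometry.Manifold

end
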